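import Mathlib
import Summits.ValiantsHypothesis.ValiantsHypothesis.Theorems.BarrierLeverDefinableEquationsLinearSizeDefs
import HarnessLib

/-!
# Linear-size circuits II: individual degrees are bounded by leaf counts

Route `BarrierLever`, crux `DefinableEquations` (stmt-ValiantsHypothesis-8745), line `registered`,
lead c3.  Semantic half of the structure theorem for the first rung: along the gate list,
`degreeOf x (value of gate i) ≤ Lf gs x i` (the number of `x`-leaves of the unfolding of gate `i`;
weighted sums and products never raise an individual degree above the sum over the operand
slots).  Corollaries in the tree's vocabulary (registered milestone
`degreeOf_le_two_pow_complexity`): a fan-in-two circuit of size `s` computes a polynomial of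
individual degree `≤ 2^s` in every variable, so `degreeOf x f ≤ 2^{L(f)}`.
-/

set_option linter.dupNamespace false

noncomputable section

namespace Summit.ValiantsHypothesis.ValiantsHypothesis.Theorems.BarrierLeverDefinableEquations

namespace LinearSize

open Literature.Computability.AlgebraicComplexity ArithCircuit MvPolynomial
open scoped BigOperators

/-! ## Individual degrees are bounded by leaf counts -/

section Degree

variable {k : Type} [CommSemiring k] {σ : Type} [DecidableEq σ]

omit [DecidableEq σ] in
/-- Individual degree of a list sum. [folklore] -/
theorem degreeOf_list_sum_le (x : σ) (L : List (MvPolynomial σ k)) :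
    (L.sum).degreeOf x ≤ (L.map fun p => p.degreeOf x).sum := by
  induction L with
  | nil => simp
  | cons p L ih =>
    rw [List.sum_cons, List.map_cons, List.sum_cons]
    exact (degreeOf_add_le _ _ _).trans
      (max_le (Nat.le_add_right _ _) (ih.trans (Nat.le_add_left _ _)))

omit [DecidableEq σ] in
/-- Individual degree of a list product. [folklore] -/
theorem degreeOf_list_prod_le (x : σ) (L : List (MvPolynomial σ k)) :
    (L.prod).degreeOf x ≤ (L.map fun p => p.degreeOf x).sum := by
  induction L with
  | nil =>
    simp only [List.prod_nil, List.map_nil, List.sum_nil, nonpos_iff_eq_zero]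
    rw [← C_1, degreeOf_C]
  | cons p L ih =>
    rw [List.prod_cons, List.map_cons, List.sum_cons]
    exact (degreeOf_mul_le _ _ _).trans (Nat.add_le_add_left ih _)

/-- Individual degree of a variable: `deg_x (X y) ≤ [y = x]`. [folklore] -/
theorem degreeOf_X_le' (x y : σ) :
    (X y : MvPolynomial σ k).degreeOf x ≤ if y = x then 1 else 0 := by
  rw [degreeOf_def]
  refine (Multiset.count_le_of_le x (degrees_X' (R := k) y)).trans ?_
  rw [Multiset.count_singleton]
  by_cases h : y = x
  · subst h; simp
  · simp [h, Ne.symm h]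

/-- **Operand slots bound degrees.** If every value `vals[j]` has `x`-degree `≤ φ j`, then the
`x`-degrees of a list of operands add up to at most `#{x-slots} + Σ_j #{slots → j} · φ j`.
[folklore] -/
theorem sum_degreeOf_operand_le (x : σ) (vals : List (MvPolynomial σ k)) (φ : ℕ → ℕ)
    (hφ : ∀ j < vals.length, (vals.getD j 0).degreeOf x ≤ φ j) (us : List (Operand k σ)) :
    (us.map fun u => (u.eval vals).degreeOf x).sum ≤
      us.countP (opIsVar x) +
        ∑ j ∈ Finset.range vals.length, us.countP (opIsRef j) * φ j := by
  induction us with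
  | nil => simp
  | cons u us ih =>
    simp only [List.map_cons, List.sum_cons, List.countP_cons, add_mul, Finset.sum_add_distrib]
    have hu : (u.eval vals).degreeOf x ≤ (if (opIsVar x u) = true then 1 else 0) +
        ∑ j ∈ Finset.range vals.length, (if (opIsRef j u) = true then 1 else 0) * φ j := by
      cases u with
      | var y =>
        simp only [Operand.eval, opIsVar, opIsRef, decide_eq_true_eq,
          Bool.false_eq_true, if_false, zero_mul, Finset.sum_const_zero, add_zero]
        exact degreeOf_X_le' x y
      | const c => simp [Operand.eval, degreeOf_C]
      | gate j =>
        simp only [Operand.eval, opIsVar, opIsRef, beq_iff_eq, Bool.false_eq_true,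
          if_false, zero_add]
        by_cases hj : j < vals.length
        · refine (hφ j hj).trans (le_of_eq ?_)
          rw [Finset.sum_eq_single j]
          · simp
          · intro j' _ hj'; simp [Ne.symm hj']
          · intro h; exact absurd (Finset.mem_range.2 hj) h
        · rw [List.getD_eq_getElem?_getD, List.getElem?_eq_none (Nat.le_of_not_lt hj)]
          simp
    omega

/-- **A gate's degree is bounded through its slots**: `deg_x (g.eval vals) ≤ varCnt g x +
Σ_{j < |vals|} refCnt g j · φ j` whenever `deg_x vals[j] ≤ φ j`. [folklore] -/
theorem degreeOf_gate_eval_le (x : σ) (vals : List (MvPolynomial σ k)) (φ : ℕ → ℕ)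
    (hφ : ∀ j < vals.length, (vals.getD j 0).degreeOf x ≤ φ j) (g : Gate k σ) :
    (g.eval vals).degreeOf x ≤
      varCnt g x + ∑ j ∈ Finset.range vals.length, refCnt g j * φ j := by
  refine le_trans ?_ (sum_degreeOf_operand_le x vals φ hφ g.args)
  cases g with
  | sum as =>
    simp only [Gate.eval, Gate.args, List.map_map]
    refine (degreeOf_list_sum_le x _).trans ?_
    rw [List.map_map]
    refine List.sum_le_sum fun a _ => ?_
    simp only [Function.comp_apply]
    rw [smul_eq_C_mul]
    exact degreeOf_C_mul_le _ _ _
  | prod us =>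
    simp only [Gate.eval, Gate.args]
    refine (degreeOf_list_prod_le x _).trans ?_
    rw [List.map_map]
    rfl

/-- **Degrees are bounded by leaf counts**: the value of gate `i` has `x`-degree at most the
number of `x`-leaves of the unfolding of gate `i`. [folklore] -/
theorem degreeOf_gateValues_getD_le (x : σ) (gs : List (Gate k σ)) :
    ∀ i < gs.length, ((gateValues gs).getD i 0).degreeOf x ≤ Lf gs x i := by
  induction gs using List.reverseRecOn with
  | nil => intro i hi; simp at hi
  | append_singleton gs g ih =>
    intro i hi
    rw [List.length_append, List.length_singleton] at hi
    rw [gateValues_append_singleton]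
    have hlen : (gateValues gs).length = gs.length := gateValues_length gs
    by_cases hlt : i < gs.length
    · rw [List.getD_eq_getElem?_getD, List.getElem?_append_left (by rw [hlen]; exact hlt),
        ← List.getD_eq_getElem?_getD, Lf_append_left gs [g] x hlt]
      exact ih i hlt
    · have hi' : i = gs.length := by omega
      subst hi'
      rw [List.getD_eq_getElem?_getD, List.getElem?_append_right (by rw [hlen]), hlen,
        Nat.sub_self]
      simp only [List.getElem?_cons_zero, Option.getD_some]
      rw [Lf_eq, gateAt_append_length]
      have h := degreeOf_gate_eval_le x (gateValues gs) (Lf gs x) (fun j hj => ?_) g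
      · rw [hlen] at h
        refine h.trans (le_of_eq ?_)
        congr 1
        refine Finset.sum_congr rfl fun j hj => ?_
        rw [Finset.mem_range] at hj
        rw [Lf_append_left gs [g] x hj]
      · rw [hlen] at hj
        exact ih j hj

/-- **Formal individual degree of a circuit**: a fan-in-two circuit of size `s` computes a
polynomial of individual degree `≤ 2^s` in every variable. [folklore] -/
theorem degreeOf_eval_le_two_pow_size [Fintype σ] (P : ArithCircuit k σ) (h2 : P.IsFanInTwo)
    (x : σ) : P.eval.degreeOf x ≤ 2 ^ P.size := by
  unfold ArithCircuit.eval
  cases hP : P.output with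
  | var y =>
    simp only [Operand.eval]
    refine (degreeOf_X_le' x y).trans ?_
    split_ifs <;> exact Nat.le_trans (by norm_num) Nat.one_le_two_pow
  | const c => simp [Operand.eval, degreeOf_C]
  | gate o =>
    simp only [Operand.eval]
    by_cases ho : o < P.gates.length
    · refine (degreeOf_gateValues_getD_le x P.gates o ho).trans ?_
      refine (Lf_le_two_pow P.gates h2 x o).trans ?_
      exact Nat.pow_le_pow_right (by norm_num) ho
    · rw [List.getD_eq_getElem?_getD, List.getElem?_eq_none
        (by rw [gateValues_length]; exact Nat.le_of_not_lt ho)]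
      simp

/-- **`deg_x f ≤ 2^{L(f)}`** for the tree's fan-in-two `complexity`. [folklore] -/
theorem degreeOf_le_two_pow_complexity [Fintype σ] (f : MvPolynomial σ k) (x : σ) :
    f.degreeOf x ≤ 2 ^ complexity f := by
  obtain ⟨P, h2, hf, hs⟩ := exists_computes_size_eq_complexity f
  rw [← hs, ← show P.eval = f from hf]
  exact degreeOf_eval_le_two_pow_size P h2 x

/-! ### Two arithmetic lemmas for the counting in `…LinearSizeDegree` -/

omit [DecidableEq σ] in
/-- `2a ≤ 2^a` for `a ≥ 1`. [folklore] -/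
theorem mul_two_le_two_pow {a : ℕ} (ha : 1 ≤ a) : a * 2 ≤ 2 ^ a := by
  induction a, ha using Nat.le_induction with
  | base => norm_num
  | succ a ha ih =>
    have : 2 ≤ 2 ^ a := by
      calc 2 = 2 ^ 1 := by norm_num
        _ ≤ 2 ^ a := Nat.pow_le_pow_right (by norm_num) ha
    calc (a + 1) * 2 = a * 2 + 2 := by ring
      _ ≤ 2 ^ a + 2 ^ a := add_le_add ih this
      _ = 2 ^ (a + 1) := by ring

omit [DecidableEq σ] in
/-- Numbers `≥ 1` with small total excess have a small product:
`(Π f) · 2^{#s} ≤ 2^{Σ f}`. [folklore] -/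
theorem prod_mul_two_pow_card_le {ι : Type} [DecidableEq ι] (s : Finset ι) (f : ι → ℕ)
    (h : ∀ i ∈ s, 1 ≤ f i) : (∏ i ∈ s, f i) * 2 ^ s.card ≤ 2 ^ (∑ i ∈ s, f i) := by
  induction s using Finset.induction_on with
  | empty => simp
  | insert a s ha ih =>
    rw [Finset.prod_insert ha, Finset.sum_insert ha, Finset.card_insert_of_notMem ha, pow_succ]
    have ha1 : f a * 2 ≤ 2 ^ f a := mul_two_le_two_pow (h a (Finset.mem_insert_self a s))
    have ih' := ih fun i hi => h i (Finset.mem_insert_of_mem hi)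
    calc f a * (∏ i ∈ s, f i) * (2 ^ s.card * 2)
        = (f a * 2) * ((∏ i ∈ s, f i) * 2 ^ s.card) := by ring
      _ ≤ 2 ^ f a * 2 ^ (∑ i ∈ s, f i) := Nat.mul_le_mul ha1 ih'
      _ = 2 ^ (f a + ∑ i ∈ s, f i) := (pow_add _ _ _).symm

end Degree


end LinearSize

open Literature.Computability.AlgebraicComplexity ArithCircuit LinearSize in
/-- **Registered milestone `degreeOf_le_two_pow_complexity`** (crux stmt-ValiantsHypothesis-8745,
line `registered`, lead c3): `deg_{x_j} f ≤ 2^{L(f)}` for the tree's fan-in-two complexity — the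
formal-degree bound through leaf counts of the unfolding. [folklore] -/
theorem degreeOf_le_two_pow_complexity :
    ∀ (n : ℕ) (f : MvPolynomial (Fin n) ℂ) (j : Fin n),
      f.degreeOf j ≤ 2 ^ Literature.Computability.AlgebraicComplexity.complexity f :=
  fun _ f j => LinearSize.degreeOf_le_two_pow_complexity f j

end Summit.ValiantsHypothesis.ValiantsHypothesis.Theorems.BarrierLeverDefinableEquations

end
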